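import Summits.PneNP.PneNP.Theorems.ExpanderLinearGeneratorsGridRoutingAssembly

/-!
# PneNP / ExpanderLinearGenerators — an exponential lower bound for bounded-depth Frege refutations
of the grid routing Tseitin system (grid routing reduction, conclusion)

Route `PneNP/ExpanderLinearGenerators`, support for crux stmt-PneNP-11443
(`LinearGeneratorDepthFregeHard`, Krajíček's Problem 19.4.5). Last file of the Urquhart–Fu /
Ben-Sasson reduction:

* `ontoPhp_depthFrege_lowerBound` — the `2^{n^ε}` form of the tree's `k`-evaluation lower bound for
  the BIJECTIVE pigeonhole principle (`lt_proofSize_of_isDepthProofOf_ontoPigeonholeForm`,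
  `KEvaluationsOnto.lean`; the arithmetic of `ProofComplexityPHPLowerBound.lean`, abstracted over
  the formula family in `depthFrege_lowerBound_of_levelSize`);
* `clauseLines_le`, `gridSize_le` — the size of the pigeonhole proof produced by the reduction is at
  most `S² · sizePoly k`, `sizePoly k = C (k+3)⁹`;
* `gridTseitin_depthFrege_lowerBound` — **for every depth `d` there are `ε > 0` and `K₀` such that
  for `k ≥ K₀` every depth-`d` `textbookFrege`-proof of `¬ ofCNF (sumEncoding 1 (gridSystem k))`
  — the XOR-CNF of the unsolvable `4`-sparse Tseitin system of the `(k+2) × (k+1)` routing grid —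
  has `proofSize ≥ 2^{k^ε}`.** An UNCONDITIONAL bounded-depth Frege lower bound for a family of
  sparse linear systems over `𝔽₂` (a weak-exponent form of Håstad's grid theorem, obtained here by
  reduction from the pigeonhole principle rather than by a switching lemma).

References: A. Urquhart, X. Fu, *Simplified lower bounds for propositional proofs*, Notre Dame
J. Formal Logic 37 (1996) 523–544; E. Ben-Sasson, *Hard examples for the bounded depth Frege
proof system*, Comput. Complexity 11 (2002) 109–136; J. Håstad, *On small-depth Frege proofs for
Tseitin for grids*, J. ACM 68 (2020); J. Krajíček, *Bounded arithmetic, propositional logic, and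
complexity theory* (CUP 1995), Thm. 12.5.3.
-/

namespace Summit.PneNP.PneNP.Theorems.GridRouting

set_option linter.dupNamespace false -- `Summit.PneNP.PneNP.…`: summit = sub-problem (D-0017)

open Filter Finset Literature.Computability.Complexity.PropForm
open Literature.Computability.Complexity (PropForm Clause CNF Literal eventually_pow_lt_two_rpow_rpow)
open Literature.Computability.MetaComplexity Literature.Computability.MetaComplexity.TextbookFrege

/-! ### The bijective pigeonhole lower bound in `2^{n^ε}` form -/

/-- **From the numeric form of Thm. 12.5.3 to `2^{n^ε}`** (the arithmetic of
`ProofComplexityPHPLowerBound.lean`, abstracted over the formula family `F`): if for every `s ≥ 1`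
and `n ≥ levelSize s (baseOf s) d` every depth-`d` proof of `F n` has size `> 2^{s+1}`, then with
`ε = 1/(2B)` for the exponent `B` of the polynomial schedule (`levelSize_poly d`) every depth-`d`
proof of `F n`, `n ≥ (2(A+1))^{2B}`, has size `≥ 2^{n^ε}`. [Krajíček 1995, Thm. 12.5.3]
[folklore] -/
theorem depthFrege_lowerBound_of_levelSize {d : ℕ} {F : ℕ → PropForm ℕ}
    (hF : ∀ {s n : ℕ}, 1 ≤ s → levelSize s (baseOf s) d ≤ n → ∀ {π : List (PropForm ℕ)},
      textbookFrege.IsDepthProofOf d π (F n) → 2 ^ (s + 1) < proofSize π) :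
    ∃ ε : ℝ, 0 < ε ∧ ∃ N : ℕ, ∀ n ≥ N, ∀ π : List (PropForm ℕ),
      textbookFrege.IsDepthProofOf d π (F n) → (2 : ℝ) ^ ((n : ℝ) ^ ε) ≤ (proofSize π : ℝ) := by
  obtain ⟨A, B, hA, hB, hAB⟩ := levelSize_poly d
  have hA1 : (1 : ℝ) ≤ A := by exact_mod_cast hA
  have hB0 : (0 : ℝ) < B := by exact_mod_cast hB
  set ε : ℝ := 1 / (2 * (B : ℝ)) with hε
  have hεpos : 0 < ε := by positivity
  have h2Bε : ((2 * B : ℕ) : ℝ) * ε = 1 := by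
    rw [hε]; push_cast; field_simp
  refine ⟨ε, hεpos, (2 * (A + 1)) ^ (2 * B), fun n hn π hπ => ?_⟩
  set y : ℝ := (n : ℝ) ^ ε with hy
  have hy0 : 0 ≤ y := Real.rpow_nonneg (Nat.cast_nonneg n) ε
  have hyN : 2 * ((A : ℝ) + 1) ≤ y := by
    have h1 : ((((2 * (A + 1)) ^ (2 * B) : ℕ) : ℝ)) ^ ε = 2 * ((A : ℝ) + 1) := by
      rw [Nat.cast_pow, ← Real.rpow_natCast, ← Real.rpow_mul (by positivity), h2Bε,
        Real.rpow_one]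
      push_cast; ring
    rw [← h1]
    exact Real.rpow_le_rpow (Nat.cast_nonneg _) (Nat.cast_le.2 hn) hεpos.le
  have hyA : (A : ℝ) + 1 ≤ y := by nlinarith
  have hy2B : y ^ (2 * B) = (n : ℝ) := by
    rw [hy, ← Real.rpow_natCast, ← Real.rpow_mul (Nat.cast_nonneg n), mul_comm, h2Bε,
      Real.rpow_one]
  have hyA' : (2 : ℝ) ≤ y ^ 2 / A := by
    rw [le_div_iff₀ (by positivity)]; nlinarith
  have ht2 : 2 ≤ ⌊y ^ 2 / (A : ℝ)⌋₊ := Nat.le_floor (by exact_mod_cast hyA')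
  obtain ⟨s, hst⟩ : ∃ s, ⌊y ^ 2 / (A : ℝ)⌋₊ = s + 1 := ⟨⌊y ^ 2 / (A : ℝ)⌋₊ - 1, by omega⟩
  have hs1 : 1 ≤ s := by omega
  have htle : ((s + 1 : ℕ) : ℝ) ≤ y ^ 2 / A := by rw [← hst]; exact Nat.floor_le (by positivity)
  have hlevel : levelSize s (baseOf s) d ≤ n := by
    have h2 : ((A * (s + 1) ^ B : ℕ) : ℝ) ≤ n := by
      push_cast
      have htB : ((s : ℝ) + 1) ^ B ≤ (y ^ 2 / A) ^ B :=
        pow_le_pow_left₀ (by positivity) (by exact_mod_cast htle) B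
      have hyB : (y ^ 2 / A) ^ B = (n : ℝ) / (A : ℝ) ^ B := by
        rw [div_pow, ← pow_mul, hy2B]
      have hAB' : (A : ℝ) ≤ (A : ℝ) ^ B := by exact_mod_cast Nat.le_self_pow (by omega) A
      have hApos : (0 : ℝ) < (A : ℝ) ^ B := by positivity
      calc (A : ℝ) * ((s : ℝ) + 1) ^ B ≤ A * ((n : ℝ) / (A : ℝ) ^ B) := by
            rw [← hyB]; exact mul_le_mul_of_nonneg_left htB (by positivity)
        _ = (n : ℝ) * (A / (A : ℝ) ^ B) := by ring
        _ ≤ (n : ℝ) * 1 := by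
            refine mul_le_mul_of_nonneg_left ?_ (Nat.cast_nonneg n)
            rw [div_le_one hApos]; exact hAB'
        _ = n := mul_one _
    have h3 : A * (s + 1) ^ B ≤ n := by exact_mod_cast h2
    exact (hAB s).trans h3
  have hmain := hF hs1 hlevel hπ
  have hexp : y ≤ ((s + 1 : ℕ) : ℝ) := by
    have hfl : y ^ 2 / A - 1 ≤ ((s + 1 : ℕ) : ℝ) := by
      have := Nat.lt_floor_add_one (y ^ 2 / (A : ℝ))
      rw [hst] at this
      linarith
    have hkey : y + 1 ≤ y ^ 2 / A := by
      rw [le_div_iff₀ (by positivity)]; nlinarith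
    linarith
  have h2 : (2 : ℝ) ^ y ≤ (2 : ℝ) ^ (((s + 1 : ℕ) : ℝ)) :=
    Real.rpow_le_rpow_of_exponent_le (by norm_num) hexp
  rw [Real.rpow_natCast] at h2
  calc (2 : ℝ) ^ ((n : ℝ) ^ ε) = (2 : ℝ) ^ y := by rw [hy]
    _ ≤ (2 : ℝ) ^ (s + 1) := h2
    _ ≤ (proofSize π : ℝ) := by exact_mod_cast hmain.le

/-- **The bounded-depth Frege lower bound for the BIJECTIVE pigeonhole principle**, `2^{n^ε}` form
(Krajíček–Pudlák–Woods 1995 / Pitassi–Beame–Impagliazzo 1993 / Ajtai 1988 in Krajíček's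
presentation, whose `PHP_n` is the bijective version; the `k`-evaluation core is the tree's
`lt_proofSize_of_isDepthProofOf_ontoPigeonholeForm`): for every depth `d` there are `ε > 0` and `N`
such that for `n ≥ N` every depth-`d` `textbookFrege`-proof of `ontoPigeonholeForm (n+1) n` has
`proofSize ≥ 2^{n^ε}`. [Krajíček 1995, Thm. 12.5.3; Krajíček 2019, Thm. 15.3.1]
[cite: Krajicek1995, Thm. 12.5.3] -/
theorem ontoPhp_depthFrege_lowerBound (d : ℕ) :
    ∃ ε : ℝ, 0 < ε ∧ ∃ N : ℕ, ∀ n ≥ N, ∀ π : List (PropForm ℕ),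
      textbookFrege.IsDepthProofOf d π (ontoPigeonholeForm (n + 1) n) →
        (2 : ℝ) ^ ((n : ℝ) ^ ε) ≤ (proofSize π : ℝ) :=
  depthFrege_lowerBound_of_levelSize (F := fun n => ontoPigeonholeForm (n + 1) n)
    (fun hs hn _ hπ => lt_proofSize_of_isDepthProofOf_ontoPigeonholeForm hs hn hπ)

/-! ### The size of the reduction is polynomial -/

/-- The exact line count of the chains. [folklore] -/
theorem chainLines_eq (k : ℕ) :
    ∀ t, chainLines k t = 5 + t * (tautLines 3 64 + 1400 * (k + 3) ^ 4 + 6000)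
  | 0 => by simp [chainLines]
  | t + 1 => by
    rw [chainLines, chainLines_eq k t, show k + 1 + 2 = k + 3 by omega]
    unfold stepLines
    ring

/-- `clauseLines k + 2352 ≤ (3 T₀ + 24000) (k+3)⁵`. [folklore] -/
theorem clauseLines_le (k : ℕ) :
    clauseLines k + 2352 ≤ (3 * tautLines 3 64 + 24000) * (k + 3) ^ 5 := by
  unfold clauseLines maxChainLines
  rw [chainLines_eq]
  unfold stepLines
  generalize tautLines 3 64 = T₀
  generalize hK : k + 3 = K
  have hk : k + 1 ≤ K := by omega
  have hK3 : 3 ≤ K := by omega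
  have hK5 : K ≤ K ^ 5 := by
    calc K = K ^ 1 := (pow_one K).symm
      _ ≤ K ^ 5 := Nat.pow_le_pow_right (by omega) (by norm_num)
  have h243 : 243 ≤ K ^ 5 := le_trans (by norm_num) (Nat.pow_le_pow_left hK3 5)
  have hA : (k + 1) * (T₀ + 1400 * K ^ 4 + 6000) ≤ K * T₀ + 1400 * K ^ 5 + 6000 * K := by
    have h1 : (k + 1) * (T₀ + 1400 * K ^ 4 + 6000) ≤ K * (T₀ + 1400 * K ^ 4 + 6000) :=
      Nat.mul_le_mul_right _ hk
    have e : K * (T₀ + 1400 * K ^ 4 + 6000) = K * T₀ + 1400 * K ^ 5 + 6000 * K := by ring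
    omega
  have hB : T₀ + 2 * (K * T₀) ≤ 3 * T₀ * K ^ 5 := by
    have : (1 + 2 * K) * T₀ ≤ (3 * K ^ 5) * T₀ := Nat.mul_le_mul_right _ (by omega)
    nlinarith
  have hC : (3 * T₀ + 24000) * K ^ 5 = 3 * T₀ * K ^ 5 + 24000 * K ^ 5 := by ring
  rw [hC]
  omega

/-- **The reduction is polynomial**: `(S (clauseLines k + 52) + 2300) (8 S Z₁ + 3000 (k+3)⁴) ≤
S² · sizePoly k` for `S ≥ 1`. [folklore] -/
theorem gridSize_le {k S : ℕ} (hS : 1 ≤ S) :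
    (S * (clauseLines k + 52) + 2300) * (8 * (S * Z₁ k) + 3000 * (k + 3) ^ 4) ≤
      S ^ 2 * sizePoly k := by
  have h1 : S * (clauseLines k + 52) + 2300 ≤ S * ((3 * tautLines 3 64 + 24000) * (k + 3) ^ 5) := by
    have := clauseLines_le k
    nlinarith
  have h2 : 8 * (S * Z₁ k) + 3000 * (k + 3) ^ 4 ≤ S * (3016 * (k + 3) ^ 4) := by
    have hZ : Z₁ k ≤ 2 * (k + 3) := by simp only [Z₁]; omega
    have h16 : k + 3 ≤ (k + 3) ^ 4 := by
      calc k + 3 = (k + 3) ^ 1 := (pow_one _).symm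
        _ ≤ (k + 3) ^ 4 := Nat.pow_le_pow_right (by omega) (by norm_num)
    nlinarith
  calc _ ≤ S * ((3 * tautLines 3 64 + 24000) * (k + 3) ^ 5) * (S * (3016 * (k + 3) ^ 4)) :=
        Nat.mul_le_mul h1 h2
    _ = S ^ 2 * sizePoly k := by unfold sizePoly sizeConst; ring

/-! ### The lower bound -/

/-- Eventually `sizePoly k < 2^{k^ε}`. [folklore] -/
theorem eventually_sizePoly_lt {ε : ℝ} (hε : 0 < ε) :
    ∀ᶠ k : ℕ in atTop, (sizePoly k : ℝ) < (2 : ℝ) ^ ((k : ℝ) ^ ε) := by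
  have h1 := eventually_pow_lt_two_rpow_rpow 10 hε
  have h2 : ∀ᶠ k : ℕ in atTop, sizePoly k ≤ k ^ 10 := by
    refine eventually_atTop.2 ⟨512 * sizeConst + 3, fun k hk => ?_⟩
    generalize hC : sizeConst = C at hk
    have hk3 : k + 3 ≤ 2 * k := by omega
    have h3 : (k + 3) ^ 9 ≤ (2 * k) ^ 9 := Nat.pow_le_pow_left hk3 9
    calc sizePoly k = C * (k + 3) ^ 9 := by rw [sizePoly, hC]
      _ ≤ C * (2 * k) ^ 9 := Nat.mul_le_mul_left _ h3
      _ = (512 * C) * k ^ 9 := by ring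
      _ ≤ k * k ^ 9 := Nat.mul_le_mul_right _ (by omega)
      _ = k ^ 10 := by ring
  filter_upwards [h1, h2] with k hk1 hk2
  calc (sizePoly k : ℝ) ≤ ((k ^ 10 : ℕ) : ℝ) := by exact_mod_cast hk2
    _ = (k : ℝ) ^ 10 := by push_cast; ring
    _ < _ := hk1

/-- Eventually `3 k^ε ≤ k^{3ε}`. [folklore] -/
theorem eventually_three_mul_rpow_le {ε : ℝ} (hε : 0 < ε) :
    ∀ᶠ k : ℕ in atTop, 3 * (k : ℝ) ^ ε ≤ (k : ℝ) ^ (3 * ε) := by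
  have hT : Tendsto (fun k : ℕ => (k : ℝ) ^ (2 * ε)) atTop atTop :=
    (tendsto_rpow_atTop (by linarith)).comp tendsto_natCast_atTop_atTop
  filter_upwards [hT.eventually_ge_atTop 3] with k hk
  have hk0 : (0 : ℝ) ≤ k := Nat.cast_nonneg k
  have e : (k : ℝ) ^ (3 * ε) = (k : ℝ) ^ ε * (k : ℝ) ^ (2 * ε) := by
    rw [← Real.rpow_add_of_nonneg hk0 hε.le (by linarith)]; ring_nf
  rw [e]
  have hkε : 0 ≤ (k : ℝ) ^ ε := Real.rpow_nonneg hk0 ε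
  nlinarith

/-- **Bounded-depth Frege refutations of the grid routing Tseitin system are exponentially long.**
For every depth `d` there are `ε > 0` and `K₀` such that for every `k ≥ K₀`, every depth-`d`
`textbookFrege`-proof of `¬ ofCNF (sumEncoding 1 (gridSystem k))` has `proofSize ≥ 2^{k^ε}`.
Proof: the reduction `exists_ontoPhp_proof_of_grid_proof` turns a proof of size `S` into a
depth-`(d+16)` proof of `ontoPigeonholeForm (k+2) (k+1)` of size `≤ S² · sizePoly k`, which by
`ontoPhp_depthFrege_lowerBound` is `≥ 2^{(k+1)^{ε₀}}`; with `ε = ε₀/3`, `S < 2^{k^ε}` would give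
`S² · sizePoly k < 2^{3 k^ε} ≤ 2^{k^{ε₀}}` for large `k`. [Urquhart–Fu 1996; Ben-Sasson 2002, Thm. 1
(for expanders); Håstad 2020 (grids, optimal exponent)] [folklore] -/
theorem gridTseitin_depthFrege_lowerBound (d : ℕ) :
    ∃ ε : ℝ, 0 < ε ∧ ∃ K₀ : ℕ, ∀ k ≥ K₀, ∀ π : List (PropForm ℕ),
      textbookFrege.IsDepthProofOf d π (neg (PropForm.ofCNF (sumEncoding 1 (gridSystem k)))) →
        (2 : ℝ) ^ ((k : ℝ) ^ ε) ≤ (proofSize π : ℝ) := by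
  obtain ⟨ε₀, hε₀, N₀, hN₀⟩ := ontoPhp_depthFrege_lowerBound (d + 16)
  set ε : ℝ := ε₀ / 3 with hε
  have hεpos : 0 < ε := by positivity
  have ev1 : ∀ᶠ k : ℕ in atTop, N₀ ≤ k + 1 := eventually_atTop.2 ⟨N₀, fun k hk => by omega⟩
  have ev2 := eventually_sizePoly_lt hεpos
  have ev3 := eventually_three_mul_rpow_le hεpos
  obtain ⟨K₀, hK₀⟩ := eventually_atTop.1 (ev1.and (ev2.and ev3))
  refine ⟨ε, hεpos, K₀, fun k hk π hπ => ?_⟩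
  obtain ⟨h1, h2, h3⟩ := hK₀ k hk
  obtain ⟨π', hπ', hsize⟩ := exists_ontoPhp_proof_of_grid_proof hπ
  -- the pigeonhole lower bound for `π'`
  have hlb := hN₀ (k + 1) h1 π' (by simpa using hπ')
  -- the size of `π'`
  have hS1 : 1 ≤ proofSize π := by
    have := TextbookFrege.size_le_proofSize_of_isDepthProofOf hπ
    have := (neg (PropForm.ofCNF (sumEncoding 1 (gridSystem k)))).size_pos
    omega
  have hub : (proofSize π' : ℝ) ≤ (proofSize π : ℝ) ^ 2 * sizePoly k := by
    exact_mod_cast hsize.trans (gridSize_le hS1)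
  by_contra hlt
  rw [not_le] at hlt
  set X : ℝ := (2 : ℝ) ^ ((k : ℝ) ^ ε) with hX
  have hX0 : 0 < X := Real.rpow_pos_of_pos two_pos _
  have hS0 : (0 : ℝ) ≤ proofSize π := Nat.cast_nonneg _
  have hSq : (proofSize π : ℝ) ^ 2 < X ^ 2 := by
    exact pow_lt_pow_left₀ hlt hS0 two_ne_zero
  have hP0 : (0 : ℝ) ≤ sizePoly k := Nat.cast_nonneg _
  have hprod : (proofSize π : ℝ) ^ 2 * sizePoly k < X ^ 2 * X := by
    calc (proofSize π : ℝ) ^ 2 * sizePoly k ≤ X ^ 2 * sizePoly k :=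
          mul_le_mul_of_nonneg_right hSq.le hP0
      _ < X ^ 2 * X := mul_lt_mul_of_pos_left h2 (by positivity)
  -- `X³ = 2^{3 k^ε} ≤ 2^{k^{ε₀}} ≤ 2^{(k+1)^{ε₀}}`
  have hX3 : X ^ 2 * X = (2 : ℝ) ^ (3 * (k : ℝ) ^ ε) := by
    rw [hX, ← pow_succ, ← Real.rpow_natCast, ← Real.rpow_mul (by norm_num)]
    norm_num; ring_nf
  have hk0 : (0 : ℝ) ≤ k := Nat.cast_nonneg k
  have hmono : (2 : ℝ) ^ (3 * (k : ℝ) ^ ε) ≤ (2 : ℝ) ^ (((k + 1 : ℕ) : ℝ) ^ ε₀) := by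
    refine Real.rpow_le_rpow_of_exponent_le (by norm_num) (h3.trans ?_)
    rw [show 3 * ε = ε₀ by rw [hε]; ring]
    exact Real.rpow_le_rpow hk0 (by push_cast; linarith) hε₀.le
  have : (proofSize π' : ℝ) < (2 : ℝ) ^ (((k + 1 : ℕ) : ℝ) ^ ε₀) :=
    calc (proofSize π' : ℝ) ≤ (proofSize π : ℝ) ^ 2 * sizePoly k := hub
      _ < X ^ 2 * X := hprod
      _ = (2 : ℝ) ^ (3 * (k : ℝ) ^ ε) := hX3
      _ ≤ _ := hmono
  exact absurd hlb (not_le.2 this)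

end Summit.PneNP.PneNP.Theorems.GridRouting
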